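import Summits.CriticalPhenomena.PercolationContinuityZ3.Theorems.PercNearOneGluingNoHeavyPcintNawFreeZ4F12Defs
import HarnessLib

/-!
# PCINT lane, kernel reduced-state B2d (`nawfree`) certificate `Z4F12` (d = 4, memory τ = 12, delay kt = 4, 12932 state classes): row checks 37 (rows [10800, 11100))

Cell `prim-pcint`, seat `prim-pcint-1` (gen 7); memo `run/shared/lean/prim/pcint/REDUCTIONS.md` §B2d (delayed chain payments with
free-neighbour shares).  Does NOT build on p205010.  Data for `NawK.le_siteCriticalProb_of_checkRowsF` (`…PcintNawFreeMemKernelCert`):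
`p = 17090/100000`, weight table `Q_k/100000`, `Q = [82910, 82910, 91055, 93944, 95423, 96322, 96925, 97359, 97685]` (`Q_k^k·100000 ≥ (100000-17090)·100000^k`, nondecreasing), `λ = 99999/100000`; Collatz–Wielandt
weights (scale 10⁹) from a power iteration, exact off-line max row ratio 0.9994858418 < λ.  Generated by work/gen6/gen_free.py
(pcint-1 gen 6; run by gen 7); the kernel re-checks every row.
-/

namespace Summit.CriticalPhenomena.PercolationContinuityZ3.Theorems.Pcint.NawFreeZ4F12

set_option maxHeartbeats 0 in
/-- Rows `[10800, 10850)` pass the check. [folklore] -/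
theorem chk_10800 : WinK.allRange (NawK.checkRowF 12 4 4 12932 17090 100000 99999 100000 NawFreeZ4F12.QL NawFreeZ4F12.syms NawFreeZ4F12.tree) 10800 10850 = true :=
  WinK.allRange_of_allRangeB (fuel := 8) (lo := 10800) (len := 50) (by decide +kernel)

set_option maxHeartbeats 0 in
/-- Rows `[10850, 10900)` pass the check. [folklore] -/
theorem chk_10850 : WinK.allRange (NawK.checkRowF 12 4 4 12932 17090 100000 99999 100000 NawFreeZ4F12.QL NawFreeZ4F12.syms NawFreeZ4F12.tree) 10850 10900 = true :=
  WinK.allRange_of_allRangeB (fuel := 8) (lo := 10850) (len := 50) (by decide +kernel)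

set_option maxHeartbeats 0 in
/-- Rows `[10900, 10950)` pass the check. [folklore] -/
theorem chk_10900 : WinK.allRange (NawK.checkRowF 12 4 4 12932 17090 100000 99999 100000 NawFreeZ4F12.QL NawFreeZ4F12.syms NawFreeZ4F12.tree) 10900 10950 = true :=
  WinK.allRange_of_allRangeB (fuel := 8) (lo := 10900) (len := 50) (by decide +kernel)

set_option maxHeartbeats 0 in
/-- Rows `[10950, 11000)` pass the check. [folklore] -/
theorem chk_10950 : WinK.allRange (NawK.checkRowF 12 4 4 12932 17090 100000 99999 100000 NawFreeZ4F12.QL NawFreeZ4F12.syms NawFreeZ4F12.tree) 10950 11000 = true :=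
  WinK.allRange_of_allRangeB (fuel := 8) (lo := 10950) (len := 50) (by decide +kernel)

set_option maxHeartbeats 0 in
/-- Rows `[11000, 11050)` pass the check. [folklore] -/
theorem chk_11000 : WinK.allRange (NawK.checkRowF 12 4 4 12932 17090 100000 99999 100000 NawFreeZ4F12.QL NawFreeZ4F12.syms NawFreeZ4F12.tree) 11000 11050 = true :=
  WinK.allRange_of_allRangeB (fuel := 8) (lo := 11000) (len := 50) (by decide +kernel)

set_option maxHeartbeats 0 in
/-- Rows `[11050, 11100)` pass the check. [folklore] -/
theorem chk_11050 : WinK.allRange (NawK.checkRowF 12 4 4 12932 17090 100000 99999 100000 NawFreeZ4F12.QL NawFreeZ4F12.syms NawFreeZ4F12.tree) 11050 11100 = true :=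
  WinK.allRange_of_allRangeB (fuel := 8) (lo := 11050) (len := 50) (by decide +kernel)

/-- Rows `[10800, 11100)` pass the check. [folklore] -/
theorem file_37 : WinK.allRange (NawK.checkRowF 12 4 4 12932 17090 100000 99999 100000 NawFreeZ4F12.QL NawFreeZ4F12.syms NawFreeZ4F12.tree) 10800 11100 = true := (WinK.allRange_split (WinK.allRange_split (WinK.allRange_split (WinK.allRange_split (WinK.allRange_split chk_10800 chk_10850) chk_10900) chk_10950) chk_11000) chk_11050)

end Summit.CriticalPhenomena.PercolationContinuityZ3.Theorems.Pcint.NawFreeZ4F12
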